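import Literature.MathematicalPhysics.QuantumLattice.GrassmannVertexPositionsProtected
import Literature.Probability.LatticeModels.KernelTreeDecayOriented
import HarnessLib

/-!
# Oriented lines: the label sums of one script and one consistent pattern with sector levels (BGM 2006, App. A4 (A4.8))

Topic `Literature/MathematicalPhysics/QuantumLattice`; companion of `GrassmannVertexPositionsProtected`
(`sum_kerProd_mul_lapWt_le_of_pinnable`: one script `s`, one consistent Laplacian pattern `π`, every vertex estimated by its
anchored norm with one PINNABLE slot pinned) and of `KernelTreeDecayOriented` (the abstract oriented tree-decay lemma
`sum_restrictK_prod_lineProd_le_oriented`).  Here the abstract lemma is applied to one script and one consistent pattern: the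
labels `Γ` carry sectors `sec : Γ → Sec`, the type-restricted covariance only joins "talking" sectors (`ov`, at most `c`
partners), the vertex kernels are restricted by a partial sector assignment `ρ` on the protected slots, every non-root vertex
`u` carries a reading `o u` of the line entering it, and the anchored norms are LEVELLED (`Nv u F`): asked with a pinnable
slot pinned fully (`hN`, level `+1`) or in position only (`hNsw`, sector summed).  Result:
`Σ_{x : x_{p₀} = w} (∏_u ‖K_u(x|_u)‖_ρ) · lapWt(lines, π, x) ≤ (c·α/2)^k ∏_u Nv u (levR ρ u + #{swapped children of u} + [u root ∨ o u])`.

* `swChildren` — the number of children of a vertex (in the script's tree) entered by a swapped line;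
* `sum_kerProdR_mul_lapWt_le_oriented` — the estimate.

Everything is proved; no named fact.

## Sources

G. Benfatto, A. Giuliani, V. Mastropietro, Ann. Henri Poincaré 7 (2006) 809–898, proof of (2.77), §2.8 (2.97)–(2.98),
App. A4 (A4.5)–(A4.8) (`BenfattoGiulianiMastropietro2006`).
-/

noncomputable section

namespace Literature.MathematicalPhysics.QuantumLattice

open GrassmannAlgebra Finset
open Literature.Probability.LatticeModels Literature.Probability.LatticeModels.BattleFederbush

section TreeDecayOriented

variable {𝕜 : Type*} [RCLike 𝕜] {Γ : Type*} [Fintype Γ] [DecidableEq Γ] {n : ℕ} (C : Matrix Γ Γ 𝕜) (cl : Γ → Fin n)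
variable {deg : Fin n → ℕ} (K : ∀ v : Fin n, (Fin (deg v) → Γ) → 𝕜)
variable {Sec : Type*} [Fintype Sec] [DecidableEq Sec]

/-- **The number of swapped children of a vertex**: the points `y (m+1)` of the script attached to `u = y (pa m)` whose entering
line is read the swapped way (`o (y (m+1)) = false`). [cite: BenfattoGiulianiMastropietro2006, App. A4 (A4.8)] -/
def swChildren {v₀ : Fin n} {k : ℕ} (s : Script v₀ k) (o : Fin n → Bool) (u : Fin n) : ℕ :=
  ∑ m : Fin k, if o (s.y m.succ) = false ∧ s.y (s.pa m) = u then 1 else 0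

/-- **The anchored sums of a block function at a pinnable position** (transport from slot functions to block labels): for
`f ≥ 0`, with the slot `τ` of `u` pinned at `a` and the positions outside `u` frozen at `0`, `Σ_x f(x|_u) ≤ Σ_{Y : Y_j = a} f Y`,
`j` the index of `τ` in `u`. [cite: BenfattoGiulianiMastropietro2006, proof of (2.77)] -/
private theorem sum_filter_block_le [AddCommGroup Γ] (τ : Fin (∑ v, deg v))
    (f : (Fin (deg (vert deg τ)) → Γ) → ℝ) (hf : ∀ Y, 0 ≤ f Y) (a : Γ) :
    ∑ x ∈ univ.filter (fun x : Fin (∑ v, deg v) → Γ => x τ = a ∧ ∀ τ', vert deg τ' ≠ vert deg τ → x τ' = 0),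
      f (fun j => x (blockEmb deg (vert deg τ) j)) ≤
      ∑ Y ∈ univ.filter (fun Y : Fin (deg (vert deg τ)) → Γ => Y (finSigmaFinEquiv.symm τ).2 = a), f Y := by
  classical
  set F := univ.filter (fun x : Fin (∑ v, deg v) → Γ => x τ = a ∧ ∀ τ', vert deg τ' ≠ vert deg τ → x τ' = 0) with hF
  set g : (Fin (∑ v, deg v) → Γ) → (Fin (deg (vert deg τ)) → Γ) := fun x j => x (blockEmb deg (vert deg τ) j) with hg
  have hinj : Set.InjOn g F := by
    intro x hx x' hx' hxx'
    funext i
    by_cases hi : vert deg i = vert deg τ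
    · obtain ⟨j, rfl⟩ := exists_eq_blockEmb deg hi
      exact congrFun hxx' j
    · rw [(mem_filter.1 (Finset.mem_coe.1 hx)).2.2 i hi, (mem_filter.1 (Finset.mem_coe.1 hx')).2.2 i hi]
  have hsum : ∑ x ∈ F, f (fun j => x (blockEmb deg (vert deg τ) j)) = ∑ Y ∈ F.image g, f Y := by
    rw [sum_image hinj]
  rw [hsum]
  refine sum_le_sum_of_subset_of_nonneg (fun Y hY => ?_) fun _ _ _ => hf _
  obtain ⟨x, hx, rfl⟩ := mem_image.1 hY
  rw [mem_filter]
  refine ⟨mem_univ _, ?_⟩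
  show x (blockEmb deg (vert deg τ) (finSigmaFinEquiv.symm τ).2) = a
  rw [blockEmb_vert]
  exact (mem_filter.1 hx).2.1

/-- **The tree-decay lemma applied to one script and one consistent pattern, with ORIENTED lines and sector levels**
(Benfatto–Giuliani–Mastropietro 2006, App. A4 (A4.8) along the proof of (2.77)).  As `sum_kerProd_mul_lapWt_le_of_pinnable`,
with: sectors `sec : Γ → Sec` and a talking relation `ov` (at most `c ≥ 1` partners of any sector) supporting the type-restricted
covariance (`hCov`); the vertex kernels restricted by a partial sector assignment `ρ` vanishing on the pinnable slots
(`restrictK`, the restricted `∏_u ‖K_u(x|_u)‖`); LEVELLED anchored norms `Nv u F ≥ 0` — for every assignment `ρ'` and every pinnable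
free slot `j` of `u`, (`hN`) `Σ_{Y : Y_j = a} ‖K_u Y‖_{ρ'} ≤ Nv u (levR ρ' u + 1)` and (`hNsw`) `∃ g ≥ 0`, the same sums `≤ g (sec a)`,
`Σ_σ g σ ≤ Nv u (levR ρ' u)`; a pattern `π` of pairwise distinct pinnable slots avoiding the root slot `p₀`; a reading
`o u` of the line entering each vertex.  Then
`Σ_{x : x_{p₀} = w} (∏_u ‖K_u(x|_u)‖_ρ) · lapWt(lines, π, x) ≤ (c·α/2)^k ∏_u Nv u (levR ρ u + swChildren u + [u = v₀ ∨ o u])`.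
[cite: BenfattoGiulianiMastropietro2006, App. A4 (A4.8); proof of (2.77); §2.8 (2.97)–(2.98)] -/
theorem sum_kerProdR_mul_lapWt_le_oriented (Pn : Fin (∑ v, deg v) → Prop) (sec : Γ → Sec) (ov : Sec → Sec → Prop)
    [DecidableRel ov] {c : ℕ} (hc1 : 1 ≤ c) (hov : ∀ σ' : Sec, (univ.filter fun σ : Sec => ov σ σ').card ≤ c)
    (hCov : ∀ ℓ X Y, typeRestrict C cl ℓ X Y ≠ 0 → ov (sec X) (sec Y) ∧ ov (sec Y) (sec X))
    (Nv : Fin n → ℕ → ℝ) (hN0 : ∀ u F, 0 ≤ Nv u F)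
    (hN : ∀ (ρ' : Fin (∑ v, deg v) → Option Sec) (u : Fin n) (j : Fin (deg u)), Pn (blockEmb deg u j) →
      ρ' (blockEmb deg u j) = none → ∀ a : Γ,
      ∑ Y ∈ univ.filter (fun Y : Fin (deg u) → Γ => Y j = a),
        (if ∀ j' σ, ρ' (blockEmb deg u j') = some σ → sec (Y j') = σ then ‖K u Y‖ else 0) ≤ Nv u (levR (vert deg) ρ' u + 1))
    (hNsw : ∀ (ρ' : Fin (∑ v, deg v) → Option Sec) (u : Fin n) (j : Fin (deg u)), Pn (blockEmb deg u j) →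
      ρ' (blockEmb deg u j) = none → ∃ g : Sec → ℝ, (∀ σ, 0 ≤ g σ) ∧
      (∀ a : Γ, ∑ Y ∈ univ.filter (fun Y : Fin (deg u) → Γ => Y j = a),
        (if ∀ j' σ, ρ' (blockEmb deg u j') = some σ → sec (Y j') = σ then ‖K u Y‖ else 0) ≤ g (sec a)) ∧
      ∑ σ, g σ ≤ Nv u (levR (vert deg) ρ' u))
    {α : ℝ} (hα : 0 ≤ α) (hrow : ∀ ℓ X, ∑ Y, ‖typeRestrict C cl ℓ X Y‖ ≤ α) (hcol : ∀ ℓ Y, ∑ X, ‖typeRestrict C cl ℓ X Y‖ ≤ α)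
    {v₀ : Fin n} {k : ℕ} (s : Script v₀ k) (hs : s.Valid) (hcov : univ.image s.y = univ)
    (π : List (Fin (∑ v, deg v) × Fin (∑ v, deg v))) (hπ : ∀ pq ∈ π, Pn pq.1 ∧ Pn pq.2)
    (hπnd : (π.map Prod.fst ++ π.map Prod.snd).Nodup)
    (o : Fin n → Bool) (ρ : Fin (∑ v, deg v) → Option Sec) (hρ : ∀ τ, Pn τ → ρ τ = none)
    (p₀ : Fin (∑ v, deg v)) (hp₀ : vert deg p₀ = v₀) (hP₀ : Pn p₀) (hp₀π : ∀ pq ∈ π, pq.1 ≠ p₀ ∧ pq.2 ≠ p₀) (w : Γ) :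
    ∑ x ∈ univ.filter (fun x : Fin (∑ v, deg v) → Γ => x p₀ = w),
        (∏ u, restrictK (vert deg) sec ρ (fun u x => ‖K u fun j => x (blockEmb deg u j)‖) u x) *
          lapWt C cl deg s.lines.reverse π x ≤
      (c * (α / 2)) ^ k * ∏ u, Nv u (levR (vert deg) ρ u + swChildren s o u + if u = v₀ ∨ o u = true then 1 else 0) := by
  have hRHS : 0 ≤ (c * (α / 2)) ^ k *
      ∏ u, Nv u (levR (vert deg) ρ u + swChildren s o u + if u = v₀ ∨ o u = true then 1 else 0) :=
    mul_nonneg (pow_nonneg (by positivity) _) (prod_nonneg fun u _ => hN0 u _)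
  have hnd : s.lines.reverse.Nodup := List.nodup_reverse.2 (Script.nodup_lines s hs)
  obtain ⟨Kn, hKn⟩ : ∃ Kn : Fin n → (Fin (∑ v, deg v) → Γ) → ℝ, Kn = fun u x => ‖K u fun j => x (blockEmb deg u j)‖ :=
    ⟨_, rfl⟩
  have hKn0 : ∀ u x, 0 ≤ Kn u x := fun u x => by rw [hKn]; exact norm_nonneg _
  by_cases hc : stepsOK (s.lines.reverse.map (lapPred deg)) π = true
  swap
  · refine le_trans (le_of_eq (sum_eq_zero fun x _ => ?_)) hRHS
    rw [lapWt_eq C cl x _ π hnd, if_neg hc, mul_zero]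
  -- the tree-decay lemma, in a transported (opaque) group structure of `Γ`
  haveI : Nonempty Γ := ⟨w⟩
  haveI : NeZero (Fintype.card Γ) := ⟨Fintype.card_ne_zero⟩
  obtain ⟨_instACG⟩ : Nonempty (AddCommGroup Γ) := ⟨(Fintype.equivFin Γ).addCommGroup⟩
  -- nodup facts of the pattern
  obtain ⟨hnd1, hnd2, hdisj⟩ := List.nodup_append.1 hπnd
  have hπN : π.Nodup := hnd1.of_map _
  have hinj1 : ∀ pq ∈ π, ∀ pq' ∈ π, pq.1 = pq'.1 → pq = pq' := fun pq hpq pq' hpq' h =>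
    List.inj_on_of_nodup_map hnd1 hpq hpq' h
  have hinj2 : ∀ pq ∈ π, ∀ pq' ∈ π, pq.2 = pq'.2 → pq = pq' := fun pq hpq pq' hpq' h =>
    List.inj_on_of_nodup_map hnd2 hpq hpq' h
  have hne12 : ∀ pq ∈ π, ∀ pq' ∈ π, pq.1 ≠ pq'.2 := fun pq hpq pq' hpq' =>
    hdisj _ (List.mem_map.2 ⟨pq, hpq, rfl⟩) _ (List.mem_map.2 ⟨pq', hpq', rfl⟩)
  -- the lines, indexed, and their steps
  obtain ⟨ℓf, hℓf⟩ : ∃ ℓf : Fin k → Sym2 (Fin n), ℓf = fun m => s(s.y (s.pa m), s.y m.succ) := ⟨_, rfl⟩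
  have hls : s.lines = List.ofFn ℓf := by rw [hℓf]; exact Script.lines_eq_ofFn s
  have hmem : ∀ m : Fin k, ℓf m ∈ s.lines.reverse := fun m => by
    rw [List.mem_reverse, hls, List.mem_ofFn]; exact ⟨m, rfl⟩
  have hne : ∀ m : Fin k, s.y (s.pa m) ≠ s.y m.succ := fun m h => by
    have := Script.y_injective s hs h
    have h2 := Script.pa_le s m
    rw [this, Fin.val_succ] at h2
    omega
  have hex := fun m : Fin k => exists_find_of_stepsOK (deg := deg) s.lines.reverse π hc (ℓf m) (hmem m)
  choose pqf hfind hpq0 using hex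
  have hpq : ∀ m, s(vert deg (pqf m).2, vert deg (pqf m).1) = s(s.y (s.pa m), s.y m.succ) := fun m => by
    rw [hpq0 m, hℓf]
  have hpqπ : ∀ m, pqf m ∈ π := fun m => (List.of_mem_zip (List.mem_of_find?_eq_some (hfind m))).2
  -- different lines have different steps
  have hzipℓ : ∀ m m' : Fin k, pqf m = pqf m' → m = m' := by
    intro m m' h
    have h1 := List.mem_of_find?_eq_some (hfind m)
    have h2 := List.mem_of_find?_eq_some (hfind m')
    rw [← h] at h2
    obtain ⟨i, hi, hi'⟩ := List.mem_iff_getElem.1 h1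
    obtain ⟨i', hi'', hi'''⟩ := List.mem_iff_getElem.1 h2
    rw [List.getElem_zip] at hi' hi'''
    have hπi : π[i]'(by rw [List.length_zip] at hi; omega) = π[i']'(by rw [List.length_zip] at hi''; omega) :=
      (Prod.ext_iff.1 hi').2.trans (Prod.ext_iff.1 hi''').2.symm
    have hii' : i = i' := (hπN.getElem_inj_iff).1 hπi
    subst hii'
    have hℓ : ℓf m = ℓf m' := (Prod.ext_iff.1 hi').1.symm.trans (Prod.ext_iff.1 hi''').1
    -- `ℓf` is injective (the lines of a valid script are distinct)
    have hlnd : (List.ofFn ℓf).Nodup := hls ▸ Script.nodup_lines s hs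
    exact (List.nodup_ofFn.1 hlnd) hℓ
  -- child / parent slots and the two-point weights of the lines, per line index
  obtain ⟨child, hchild⟩ : ∃ child : Fin k → Fin (∑ v, deg v),
      child = fun m => if vert deg (pqf m).1 = s.y m.succ then (pqf m).1 else (pqf m).2 := ⟨_, rfl⟩
  obtain ⟨parent, hparent⟩ : ∃ parent : Fin k → Fin (∑ v, deg v),
      parent = fun m => if vert deg (pqf m).1 = s.y m.succ then (pqf m).2 else (pqf m).1 := ⟨_, rfl⟩
  obtain ⟨hf, hhf⟩ : ∃ hf : Fin k → Γ → Γ → ℝ, hf = fun m b b' => if vert deg (pqf m).1 = s.y m.succ then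
      1 / 2 * ‖typeRestrict C cl (ℓf m) b b'‖ else 1 / 2 * ‖typeRestrict C cl (ℓf m) b' b‖ := ⟨_, rfl⟩
  have hvc : ∀ m, vert deg (child m) = s.y m.succ := by
    intro m
    simp only [hchild]
    split_ifs with h1
    · exact h1
    · rcases Sym2.eq_iff.1 (hpq m) with ⟨-, h⟩ | ⟨h, -⟩
      · exact absurd h h1
      · exact h
  have hvp : ∀ m, vert deg (parent m) = s.y (s.pa m) := by
    intro m
    simp only [hparent]
    split_ifs with h1
    · rcases Sym2.eq_iff.1 (hpq m) with ⟨h, -⟩ | ⟨-, h⟩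
      · exact h
      · exact absurd (h.symm.trans h1) (hne m)
    · rcases Sym2.eq_iff.1 (hpq m) with ⟨-, h⟩ | ⟨-, h⟩
      · exact absurd h h1
      · exact h
  have hPc : ∀ m, Pn (child m) := fun m => by
    simp only [hchild]; split_ifs; exacts [(hπ _ (hpqπ m)).1, (hπ _ (hpqπ m)).2]
  have hPp : ∀ m, Pn (parent m) := fun m => by
    simp only [hparent]; split_ifs; exacts [(hπ _ (hpqπ m)).2, (hπ _ (hpqπ m)).1]
  -- components of the steps: `comp true pq = pq.1`, `comp false pq = pq.2`
  obtain ⟨comp, hcompd⟩ : ∃ comp : Bool → Fin (∑ v, deg v) × Fin (∑ v, deg v) → Fin (∑ v, deg v),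
      comp = fun b pq => if b then pq.1 else pq.2 := ⟨_, rfl⟩
  have hcomp : ∀ (m m' : Fin k) (b b' : Bool), comp b (pqf m) = comp b' (pqf m') → m = m' ∧ b = b' := by
    intro m m' b b' h
    cases b <;> cases b' <;> simp only [hcompd, if_true, if_false, Bool.false_eq_true] at h
    · exact ⟨hzipℓ m m' (hinj2 _ (hpqπ m) _ (hpqπ m') h), rfl⟩
    · exact absurd h.symm (hne12 _ (hpqπ m') _ (hpqπ m))
    · exact absurd h (hne12 _ (hpqπ m) _ (hpqπ m'))
    · exact ⟨hzipℓ m m' (hinj1 _ (hpqπ m) _ (hpqπ m') h), rfl⟩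
  have hchild_eq : ∀ m, child m = comp (decide (vert deg (pqf m).1 = s.y m.succ)) (pqf m) := fun m => by
    simp only [hchild, hcompd]
    by_cases h : vert deg (pqf m).1 = s.y m.succ <;> simp [h]
  have hparent_eq : ∀ m, parent m = comp (!decide (vert deg (pqf m).1 = s.y m.succ)) (pqf m) := fun m => by
    simp only [hparent, hcompd]
    by_cases h : vert deg (pqf m).1 = s.y m.succ <;> simp [h]
  have hp0 : ∀ m, parent m ≠ p₀ := fun m => by
    simp only [hparent]; split_ifs; exacts [(hp₀π _ (hpqπ m)).2, (hp₀π _ (hpqπ m)).1]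
  -- vertex-indexed data
  have hyinj := Script.y_injective s hs
  obtain ⟨idx, hidx⟩ : ∃ idx : Fin n → Fin (k + 1), idx = Function.invFun s.y := ⟨_, rfl⟩
  have hidxy : ∀ m : Fin (k + 1), idx (s.y m) = m := fun m => by
    rw [hidx]; exact Function.leftInverse_invFun hyinj m
  obtain ⟨eS, heS⟩ : ∃ eS : Fin n → Fin (∑ v, deg v),
      eS = fun u => Fin.cases (motive := fun _ => Fin (∑ v, deg v)) p₀ child (idx u) := ⟨_, rfl⟩
  obtain ⟨pS, hpS⟩ : ∃ pS : Fin n → Fin (∑ v, deg v),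
      pS = fun u => Fin.cases (motive := fun _ => Fin (∑ v, deg v)) p₀ parent (idx u) := ⟨_, rfl⟩
  obtain ⟨hh, hhh⟩ : ∃ hh : Fin n → Γ → Γ → ℝ,
      hh = fun u => Fin.cases (motive := fun _ => Γ → Γ → ℝ) (fun _ _ => (0 : ℝ)) hf (idx u) := ⟨_, rfl⟩
  have heSm : ∀ m : Fin k, eS (s.y m.succ) = child m := fun m => by
    simp only [heS, hidxy, Fin.cases_succ]
  have hpSm : ∀ m : Fin k, pS (s.y m.succ) = parent m := fun m => by
    simp only [hpS, hidxy, Fin.cases_succ]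
  have hhm : ∀ m : Fin k, hh (s.y m.succ) = hf m := fun m => by
    simp only [hhh, hidxy, Fin.cases_succ]
  have hf0 : ∀ m b b', 0 ≤ hf m b b' := fun m b b' => by
    simp only [hhf]; split_ifs <;> positivity
  have hfrow : ∀ m b, ∑ b', hf m b b' ≤ α / 2 := fun m b => by
    simp only [hhf]
    split_ifs
    · rw [← mul_sum]; linarith [hrow (ℓf m) b]
    · rw [← mul_sum]; linarith [hcol (ℓf m) b]
  have hfov : ∀ m b b', hf m b b' ≠ 0 → ov (sec b) (sec b') := fun m b b' h => by
    simp only [hhf] at h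
    split_ifs at h
    · exact (hCov (ℓf m) b b' fun h' => h (by rw [h', norm_zero, mul_zero])).1
    · exact (hCov (ℓf m) b' b fun h' => h (by rw [h', norm_zero, mul_zero])).2
  have hh0 : ∀ z b b', 0 ≤ hh z b b' := fun z b b' => by
    simp only [hhh]
    generalize idx z = j
    cases j using Fin.cases with
    | zero => simp
    | succ m => simp only [Fin.cases_succ]; exact hf0 m b b'
  have hhrow : ∀ z b, ∑ b', hh z b b' ≤ α / 2 := fun z b => by
    simp only [hhh]
    generalize idx z = j
    cases j using Fin.cases with
    | zero => simp only [Fin.cases_zero, sum_const_zero]; positivity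
    | succ m => simp only [Fin.cases_succ]; exact hfrow m b
  have hhov : ∀ z b b', hh z b b' ≠ 0 → ov (sec b) (sec b') := fun z b b' => by
    simp only [hhh]
    generalize idx z = j
    cases j using Fin.cases with
    | zero => simp
    | succ m => simp only [Fin.cases_succ]; exact hfov m b b'
  -- the restricted kernels: slots ↔ blocks, locality, and the levelled norms
  have hRB : ∀ (ρ' : Fin (∑ v, deg v) → Option Sec) (u : Fin n) (x : Fin (∑ v, deg v) → Γ),
      restrictK (vert deg) sec ρ' Kn u x =
        (if ∀ j' σ, ρ' (blockEmb deg u j') = some σ → sec (x (blockEmb deg u j')) = σ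
          then ‖K u fun j => x (blockEmb deg u j)‖ else 0) := by
    intro ρ' u x
    rw [hKn]
    unfold restrictK
    have hiff : (∀ τ, vert deg τ = u → ∀ σ, ρ' τ = some σ → sec (x τ) = σ) ↔
        (∀ j' σ, ρ' (blockEmb deg u j') = some σ → sec (x (blockEmb deg u j')) = σ) := by
      constructor
      · exact fun h j' σ hσ => h _ (vert_blockEmb deg u j') σ hσ
      · intro h τ hτ σ hσ
        obtain ⟨j', rfl⟩ := exists_eq_blockEmb deg hτ
        exact h j' σ hσ
    by_cases hx : ∀ τ, vert deg τ = u → ∀ σ, ρ' τ = some σ → sec (x τ) = σ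
    · rw [if_pos hx, if_pos (hiff.1 hx)]
    · rw [if_neg hx, if_neg fun h' => hx (hiff.2 h')]
  have hKloc : ∀ u (x x' : Fin (∑ v, deg v) → Γ), (∀ τ, vert deg τ = u → x τ = x' τ) → Kn u x = Kn u x' := by
    intro u x x' hxx'
    rw [hKn]
    show ‖K u fun j => x (blockEmb deg u j)‖ = ‖K u fun j => x' (blockEmb deg u j)‖
    rw [show (fun j => x (blockEmb deg u j)) = fun j => x' (blockEmb deg u j) from
      funext fun j => hxx' _ (vert_blockEmb deg u j)]
  have hKN' : ∀ (ρ' : Fin (∑ v, deg v) → Option Sec) (u : Fin n) (τ : Fin (∑ v, deg v)), vert deg τ = u → Pn τ →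
      ρ' τ = none → ∀ a : Γ,
      ∑ x ∈ univ.filter (fun x : Fin (∑ v, deg v) → Γ => x τ = a ∧ ∀ τ', vert deg τ' ≠ u → x τ' = 0),
        restrictK (vert deg) sec ρ' Kn u x ≤ Nv u (levR (vert deg) ρ' u + 1) := by
    intro ρ' u τ hτ hPτ hρτ a
    have hPj : Pn (blockEmb deg (vert deg τ) (finSigmaFinEquiv.symm τ).2) := by rwa [blockEmb_vert]
    have hρj : ρ' (blockEmb deg (vert deg τ) (finSigmaFinEquiv.symm τ).2) = none := by rwa [blockEmb_vert]
    subst hτ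
    simp_rw [hRB ρ' (vert deg τ)]
    exact le_trans (sum_filter_block_le τ
      (fun Y => if ∀ j' σ, ρ' (blockEmb deg (vert deg τ) j') = some σ → sec (Y j') = σ then ‖K (vert deg τ) Y‖ else 0)
      (fun Y => by split_ifs; exacts [norm_nonneg _, le_rfl]) a) (hN ρ' (vert deg τ) _ hPj hρj a)
  have hKsw' : ∀ (ρ' : Fin (∑ v, deg v) → Option Sec) (u : Fin n) (τ : Fin (∑ v, deg v)), vert deg τ = u → Pn τ →
      ρ' τ = none → ∃ g : Sec → ℝ, (∀ σ, 0 ≤ g σ) ∧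
      (∀ a : Γ, ∑ x ∈ univ.filter (fun x : Fin (∑ v, deg v) → Γ => x τ = a ∧ ∀ τ', vert deg τ' ≠ u → x τ' = 0),
        restrictK (vert deg) sec ρ' Kn u x ≤ g (sec a)) ∧ ∑ σ, g σ ≤ Nv u (levR (vert deg) ρ' u) := by
    intro ρ' u τ hτ hPτ hρτ
    have hPj : Pn (blockEmb deg (vert deg τ) (finSigmaFinEquiv.symm τ).2) := by rwa [blockEmb_vert]
    have hρj : ρ' (blockEmb deg (vert deg τ) (finSigmaFinEquiv.symm τ).2) = none := by rwa [blockEmb_vert]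
    subst hτ
    obtain ⟨g, hg0, hgpt, hgsum⟩ := hNsw ρ' (vert deg τ) _ hPj hρj
    refine ⟨g, hg0, fun a => ?_, hgsum⟩
    simp_rw [hRB ρ' (vert deg τ)]
    exact le_trans (sum_filter_block_le τ
      (fun Y => if ∀ j' σ, ρ' (blockEmb deg (vert deg τ) j') = some σ → sec (Y j') = σ then ‖K (vert deg τ) Y‖ else 0)
      (fun Y => by split_ifs; exacts [norm_nonneg _, le_rfl]) a) (hgpt a)
  -- hypotheses on the points of the script
  have hpt : ∀ m : Fin k, vert deg (eS (s.y m.succ)) = s.y m.succ ∧ Pn (eS (s.y m.succ)) ∧ Pn (pS (s.y m.succ)) ∧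
      ρ (eS (s.y m.succ)) = none ∧ ∃ j : Fin (k + 1), (j : ℕ) ≤ (m : ℕ) ∧ vert deg (pS (s.y m.succ)) = s.y j := by
    intro m
    rw [heSm, hpSm]
    exact ⟨hvc m, hPc m, hPp m, hρ _ (hPc m), s.pa m, Script.pa_le s m, hvp m⟩
  have hsw : ∀ m : Fin k, o (s.y m.succ) = false → ρ (pS (s.y m.succ)) = none ∧ pS (s.y m.succ) ≠ p₀ ∧
      (∀ m' : Fin k, pS (s.y m.succ) ≠ eS (s.y m'.succ)) ∧
      ∀ m' : Fin k, o (s.y m'.succ) = false → pS (s.y m.succ) = pS (s.y m'.succ) → m = m' := by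
    intro m _
    rw [hpSm]
    refine ⟨hρ _ (hPp m), hp0 m, fun m' => ?_, fun m' _ h => ?_⟩
    · rw [heSm, hparent_eq, hchild_eq]
      intro h
      obtain ⟨rfl, hb⟩ := hcomp m m' _ _ h
      cases hd : decide (vert deg (pqf m).1 = s.y m.succ) <;> simp [hd] at hb
    · rw [hpSm, hparent_eq, hparent_eq] at h
      exact (hcomp m m' _ _ h).1
  -- the abstract oriented tree-decay lemma
  -- (the anchored-norm hypotheses are passed through `convert`: the decidability instances of the filters differ)
  have hE := sum_restrictK_prod_lineProd_le_oriented (Λ := Γ) (vert deg) Pn sec ov hc1 hov Kn hKn0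
    hKloc Nv hN0 (fun ρ' u τ hτ hPτ hρτ a => by convert hKN' ρ' u τ hτ hPτ hρτ a using 3)
    (fun ρ' u τ hτ hPτ hρτ => by
      obtain ⟨g, hg0, hgpt, hgsum⟩ := hKsw' ρ' u τ hτ hPτ hρτ
      exact ⟨g, hg0, fun a => by convert hgpt a using 3, hgsum⟩)
    (Γ := α / 2) (by positivity) hh hh0 hhrow hhov eS pS o s hs ρ p₀ hp₀ hP₀ (hρ p₀ hP₀) hpt hsw w
  -- the levels
  have hswc : ∀ u, swCount (vert deg) pS o s u = swChildren s o u := fun u => by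
    unfold swCount swChildren
    refine sum_congr rfl fun m _ => ?_
    rw [hpSm, hvp]
  have hroot : ∀ m : Fin k, ¬ (s.y m.succ = v₀) := fun m h => by
    have := hyinj (h.trans (Script.y_zero s).symm)
    exact Fin.succ_ne_zero _ this
  have hR : Nv v₀ (levR (vert deg) ρ v₀ + swCount (vert deg) pS o s v₀ + 1) *
      ((c * (α / 2)) ^ k * ∏ m : Fin k, Nv (s.y m.succ)
        (levR (vert deg) ρ (s.y m.succ) + swCount (vert deg) pS o s (s.y m.succ) + if o (s.y m.succ) = true then 1 else 0)) =
      (c * (α / 2)) ^ k * ∏ u, Nv u (levR (vert deg) ρ u + swChildren s o u + if u = v₀ ∨ o u = true then 1 else 0) := by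
    have hprod : ∏ u, Nv u (levR (vert deg) ρ u + swChildren s o u + if u = v₀ ∨ o u = true then 1 else 0) =
        ∏ m : Fin (k + 1), Nv (s.y m)
          (levR (vert deg) ρ (s.y m) + swChildren s o (s.y m) + if s.y m = v₀ ∨ o (s.y m) = true then 1 else 0) := by
      rw [← prod_image (s := univ) (g := s.y)
        (f := fun u => Nv u (levR (vert deg) ρ u + swChildren s o u + if u = v₀ ∨ o u = true then 1 else 0))
        fun m _ m' _ h => hyinj h, hcov]
    rw [hprod, Fin.prod_univ_succ, Script.y_zero]
    simp only [hswc, hroot, false_or, true_or, if_true]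
    ring
  -- the left-hand side
  have hE' : ∑ x ∈ univ.filter (fun x : Fin (∑ v, deg v) → Γ => x p₀ = w ∧ ∀ τ, vert deg τ ∉ univ.image s.y → x τ = 0),
      (∏ u ∈ univ.image s.y, restrictK (vert deg) sec ρ Kn u x) *
        ∏ m : Fin k, hh (s.y m.succ) (x (pS (s.y m.succ))) (x (eS (s.y m.succ))) ≤
      Nv v₀ (levR (vert deg) ρ v₀ + swCount (vert deg) pS o s v₀ + 1) *
      ((c * (α / 2)) ^ k * ∏ m : Fin k, Nv (s.y m.succ)
        (levR (vert deg) ρ (s.y m.succ) + swCount (vert deg) pS o s (s.y m.succ) + if o (s.y m.succ) = true then 1 else 0)) := by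
    convert hE using 3
  subst hKn
  refine le_trans (le_of_eq ?_) (hE'.trans_eq hR)
  refine sum_congr (filter_congr fun x _ => ?_) fun x _ => ?_
  · simp [hcov]
  · rw [hcov, lapWt_eq C cl x _ π hnd, if_pos hc, List.map_reverse, List.prod_reverse, hls, List.map_ofFn, List.prod_ofFn]
    congr 1
    refine prod_congr rfl fun m _ => ?_
    rw [Function.comp_apply, hhm, hpSm, heSm, lineWt]
    rw [← hls, hfind m]
    simp only [hhf, hparent, hchild]
    split_ifs <;> rfl

end TreeDecayOriented

end Literature.MathematicalPhysics.QuantumLattice
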